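import Literature.AlgebraicGeometry.Motives.HodgeStructureOfCMTypeBasis
import Literature.NumberTheory.ComplexMultiplication.EmbeddingAction
import Mathlib.RingTheory.PiTensorProduct
import HarnessLib

/-!
# Coordinates on the tensor spaces `T^{a,b}(K) ⊗ ℂ` of the Hodge structure of a CM type

For a number field `K`, the tensor spaces `T^{a,b} V = V^{⊗a} ⊗ (V^∨)^{⊗b}` of `V = K`
(`hodgeTensorSpace K a b`, Deligne, LNM 900, I §3.1) acquire, after extension of scalars to `ℂ`, the
tensor basis `E_y = (⊗ᵢ e_{sᵢ}) ⊗ (⊗ⱼ e^∨_{tⱼ})` indexed by `y = (s, t) ∈ Hom(K,ℂ)^a × Hom(K,ℂ)^b`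
(`hodgeTensorBasis (cmBasis K) a b`, built on the eigen-basis `e_σ` of `V_ℂ = ℂ ⊗ K` of
`Motives/HodgeStructureOfCMTypeBasis`).  This is the eigen-decomposition of `T^{a,b}(K) ⊗ ℂ` under the
split torus `(K ⊗ ℂ)^× = (ℂ^×)^{Hom(K,ℂ)}`: the line `ℂ E_y` has character `Σᵢ e_{sᵢ} − Σⱼ e_{tⱼ}` and,
for a CM type `Φ`, Hodge type `(P, −P)` with `P = #{i | sᵢ ∈ Φ} − #{j | tⱼ ∈ Φ}`
(`tensorDegree (cmDeg Φ) y`) — the bookkeeping behind Deligne's Example 3.7 / Pohlmann's theorem.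
This file PROVES, for the **coordinate functionals** `t ↦ (E-coordinate of ι t at y)`
(`cmTensorCoord y : T^{a,b}(K) →ₗ[ℚ] ℂ`):

* `cmTensorCoord_tprod_tmul_tprod` — the value on a pure tensor `(⊗ vᵢ) ⊗ (⊗ φⱼ)` is
  `∏ᵢ sᵢ(vᵢ) · ∏ⱼ tⱼ(wⱼ)` where `φⱼ = Tr_{K/ℚ}(wⱼ · –)` (every functional is of this form,
  `traceDualEquiv`);
* `cmTensorCoord_smul` — **`Aut(ℂ)`-equivariance**: `coord_{g • y} (t) = g (coord_y (t))` for
  `g ∈ Aut(ℂ)` acting on the indices by composition (the tensors `t` being RATIONAL);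
* `mem_hodgeClasses_tensorSpace_ofCMType_iff` — a rational tensor of weight `0` is a Hodge class of
  type `(0,0)` for `V¹_{(K,Φ)}` iff its non-zero coordinates sit at indices of degree `0`;
* `cmTensorCoord_tensorDerivation_lmul` — the derivation action of multiplication by `x ∈ K` multiplies
  the `y`-coordinate by `Σᵢ sᵢ(x) − Σⱼ tⱼ(x)`;
* `cmTensorCoord_tensorOfCMAlgebra` — under the parametrisation of `T^{a,b}(K)` by the commutative
  `ℚ`-algebra `K^{⊗(a+b)}` (`tensorOfCMAlgebra`), the `y`-coordinate is the CHARACTER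
  `embProdHom y : K^{⊗(a+b)} →ₐ[ℚ] ℂ`, `⊗ₖ uₖ ↦ ∏ₖ yₖ(uₖ)`; `embProdHom_smul`, `embProdHom_injective`.

These are the inputs of both halves of `dim MT(V¹_{(K,Φ)}) = rank(Φ)` (files
`Motives/MumfordTateRankOfCMType` (lower bound, cell row INFRA-03-2) and
`Motives/MumfordTateRankOfCMTypeUpperBound` (row INFRA-03-3)).

Everything is a theorem or a definition with a body; no named fact is introduced (net debt `0`).

## Sources

* P. Deligne, *Hodge cycles on abelian varieties* (notes by J. S. Milne), LNM 900 (1982)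
  [Deligne1982HodgeCycles], I §3.1 (tensor spaces `T^{a,b}`, the action of `GL(V)`), proof of
  Prop. 3.4 (a tensor of type `(P,Q)` is an eigenvector of `μ(𝔾ₘ)`), Example 3.7 ("`H₁(A) ⊗ ℂ ≃
  E ⊗_ℚ ℂ → ℂ^S`, `u ⊗ 1 ↦ (σu)_{σ ∈ S}`"; "`X(E^*) = ℤ^S`").
* H. Pohlmann, *Algebraic cycles on abelian varieties of complex multiplication type*, Ann. of Math.
  88 (1968) [Pohlmann1968], §1–2 (Hodge classes on `A_Φⁿ` read off the Galois action on monomials in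
  the eigen-coordinates), as surveyed in [Gordon1999HodgeAVSurvey] §9.2.

## Provenance

Cell `pub-hodgecm2` (COR-CM), literature infrastructure row INFRA-03-2 of `LIT-FANOUT-PLAN` §B-v5 (R11),
seat `pub-hodgecm2-b16` (gen 11).
-/

noncomputable section

open scoped TensorProduct PiTensorProduct Classical Pointwise
open Module

namespace Literature.AlgebraicGeometry.Motives

namespace HodgeStructure

open RealMult (embCoords embCoords_tmul)
open Literature.NumberTheory.ComplexMultiplication

variable {K : Type} [Field K] [NumberField K]

/-! ### Rational functionals on `K` through the trace form -/

variable (K) in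
/-- **Every `ℚ`-linear functional on `K` is `Tr_{K/ℚ}(w · –)` for a unique `w`**: the trace form of a
number field is nondegenerate (Mathlib `traceForm_nondegenerate`), packaged as a linear equivalence
`K ≃ K^∨`. [folklore] -/
def traceDualEquiv : K ≃ₗ[ℚ] Module.Dual ℚ K :=
  (Algebra.traceForm ℚ K).toDual (traceForm_nondegenerate ℚ K)

/-- `traceDualEquiv K w = Tr(w · –)` (the trace pairing `Tr_{K/ℚ}(xy)` identifies `K` with its dual).
[cite: GreenGriffithsKerr2012, §V.D] -/
theorem traceDualEquiv_apply (w : K) : traceDualEquiv K w = Algebra.traceForm ℚ K w := rfl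

/-- **A complexified rational functional on the eigen-basis**: `φ_ℂ(e_τ) = τ(w)` for `φ = Tr(w · –)`,
i.e. `φ_ℂ = Σ_τ τ(w) e^∨_τ` (the dual torus coordinates). [cite: Deligne1982HodgeCycles, I Ex. 3.7] -/
theorem dual_baseChange_cmBasis (φ : Module.Dual ℚ K) (τ : K →+* ℂ) :
    Module.Dual.baseChange ℂ φ (cmBasis K τ) = τ ((traceDualEquiv K).symm φ) := by
  conv_lhs => rw [← (traceDualEquiv K).apply_symm_apply φ]
  rw [traceDualEquiv_apply, traceForm_baseChange_cmBasis]

/-! ### The coordinate functionals -/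

variable {a b : ℕ}

/-- **The `y`-coordinate of a rational tensor**: for `y = (s, t) ∈ Hom(K,ℂ)^a × Hom(K,ℂ)^b`, the
coefficient of `ι t ∈ T^{a,b}(K) ⊗ ℂ` along the tensor basis vector `E_y = (⊗ e_{sᵢ}) ⊗ (⊗ e^∨_{tⱼ})`
(`hodgeTensorBasis (cmBasis K) a b`), as a `ℚ`-linear functional of `t` — the projection to the
eigen-line of the split torus with character `Σ e_{sᵢ} − Σ e_{tⱼ}` (Deligne I §3.1, proof of 3.4).
[cite: Deligne1982HodgeCycles, I §3.1] -/
def cmTensorCoord (y : (Fin a → (K →+* ℂ)) × (Fin b → (K →+* ℂ))) :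
    hodgeTensorSpace K a b →ₗ[ℚ] ℂ :=
  (((hodgeTensorBasis (cmBasis K) a b).coord y).restrictScalars ℚ) ∘ₗ tensorSpaceToBaseChange ℂ K a b

/-- Unfolding: `cmTensorCoord y t` is the `E_y`-coordinate of `ι t`. [cite: Deligne1982HodgeCycles, I §3.1] -/
theorem cmTensorCoord_apply (y : (Fin a → (K →+* ℂ)) × (Fin b → (K →+* ℂ)))
    (t : hodgeTensorSpace K a b) :
    cmTensorCoord y t = (hodgeTensorBasis (cmBasis K) a b).repr (tensorSpaceToBaseChange ℂ K a b t) y :=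
  rfl

/-- **Coordinates of a pure tensor**: the `(s,t)`-coordinate of `(⊗ᵢ vᵢ) ⊗ (⊗ⱼ φⱼ)` is
`∏ᵢ sᵢ(vᵢ) · ∏ⱼ (φⱼ)_ℂ(e_{tⱼ})` (`1 ⊗ v = Σ_σ σ(v) e_σ`). [cite: Deligne1982HodgeCycles, I Ex. 3.7] -/
theorem cmTensorCoord_tprod_tmul_tprod' (y : (Fin a → (K →+* ℂ)) × (Fin b → (K →+* ℂ)))
    (v : Fin a → K) (φ : Fin b → Module.Dual ℚ K) :
    cmTensorCoord y (PiTensorProduct.tprod ℚ v ⊗ₜ[ℚ] PiTensorProduct.tprod ℚ φ) =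
      (∏ i, y.1 i (v i)) * ∏ j, Module.Dual.baseChange ℂ (φ j) (cmBasis K (y.2 j)) := by
  obtain ⟨s, t⟩ := y
  rw [cmTensorCoord_apply, tensorSpaceToBaseChange_tprod_tmul_tprod, hodgeTensorBasis,
    Module.Basis.tensorProduct_repr_tmul_apply, Basis.piTensorProduct_repr_tprod_apply,
    Basis.piTensorProduct_repr_tprod_apply, smul_eq_mul, mul_comm]
  congr 1
  · refine Finset.prod_congr rfl fun i _ => ?_
    rw [cmBasis_repr, embCoords_tmul, one_mul]
  · refine Finset.prod_congr rfl fun j _ => ?_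
    rw [Module.Basis.dualBasis_repr]

/-- **Coordinates of a pure tensor, trace-form version**: the `(s,t)`-coordinate of
`(⊗ᵢ vᵢ) ⊗ (⊗ⱼ Tr(wⱼ · –))` is `∏ᵢ sᵢ(vᵢ) · ∏ⱼ tⱼ(wⱼ)`. [cite: Deligne1982HodgeCycles, I Ex. 3.7] -/
theorem cmTensorCoord_tprod_tmul_tprod (y : (Fin a → (K →+* ℂ)) × (Fin b → (K →+* ℂ)))
    (v : Fin a → K) (φ : Fin b → Module.Dual ℚ K) :
    cmTensorCoord y (PiTensorProduct.tprod ℚ v ⊗ₜ[ℚ] PiTensorProduct.tprod ℚ φ) =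
      (∏ i, y.1 i (v i)) * ∏ j, y.2 j ((traceDualEquiv K).symm (φ j)) := by
  rw [cmTensorCoord_tprod_tmul_tprod']
  congr 1
  exact Finset.prod_congr rfl fun j _ => dual_baseChange_cmBasis (φ j) (y.2 j)

/-! ### `Aut(ℂ)`-equivariance of the coordinates of rational tensors -/

/-- **`Aut(ℂ)`-equivariance of the coordinates of RATIONAL tensors**: for `g ∈ Aut(ℂ)` acting on the
indices by composition (`(g • y) = (g ∘ sᵢ, g ∘ tⱼ)`), `coord_{g • y}(t) = g(coord_y(t))` for every
`t ∈ T^{a,b}(K)` — on pure tensors both sides are `∏ g(sᵢ(vᵢ)) ∏ g(tⱼ(wⱼ))`.  This is the Galois action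
on the characters of the torus `E^*`, "`σ ∈ Aut(ℂ/ℚ)`" ↔ "`τ ∈ Gal`" of Pohlmann's proof.
[cite: Deligne1982HodgeCycles, I Ex. 3.7] [cite: Gordon1999HodgeAVSurvey, §9.2 (proof)] -/
theorem cmTensorCoord_smul (g : ℂ ≃+* ℂ) (y : (Fin a → (K →+* ℂ)) × (Fin b → (K →+* ℂ)))
    (t : hodgeTensorSpace K a b) : cmTensorCoord (g • y) t = g (cmTensorCoord y t) := by
  suffices h : cmTensorCoord (g • y) =
      (g : ℂ →+* ℂ).toRatAlgHom.toLinearMap ∘ₗ cmTensorCoord (K := K) (a := a) (b := b) y from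
    LinearMap.congr_fun h t
  ext v φ
  simp only [LinearMap.compMultilinearMap_apply, TensorProduct.AlgebraTensorModule.curry_apply,
    TensorProduct.curry_apply, LinearMap.coe_restrictScalars, LinearMap.coe_comp, Function.comp_apply,
    AlgHom.toLinearMap_apply, RingHom.toRatAlgHom_apply, RingHom.coe_coe,
    cmTensorCoord_tprod_tmul_tprod, map_mul, map_prod]
  rfl

/-! ### Hodge classes of type `(0,0)` and the derivation action, in coordinates -/

variable (Φ : CMType K)

/-- **Hodge classes of type `(0,0)` in coordinates**: a rational tensor `t ∈ T^{a,b}(K)` of weight `0`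
(`a = b`) is a Hodge class of type `(0,0)` for `V¹_{(K,Φ)}` iff every index `y` carrying a non-zero
coordinate of `t` has degree `Σᵢ [sᵢ ∈ Φ] − Σⱼ [tⱼ ∈ Φ] = 0` — "the tensors of type `(0,0)` are exactly
those fixed by `μ(𝔾ₘ)`" read in the eigen-basis (Deligne I, proof of 3.4; Pohlmann's monomial criterion).
[cite: Deligne1982HodgeCycles, I Prop. 3.4 (proof)] [cite: Gordon1999HodgeAVSurvey, §9.2] -/
theorem mem_hodgeClasses_tensorSpace_ofCMType_iff [HodgeTensorFacts.{0, 0}] (hab : ((a : ℤ) - b) * 1 = 0)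
    (t : hodgeTensorSpace K a b) :
    t ∈ ((ofCMType Φ).tensorSpace a b).hodgeClasses 0 ↔
      ∀ y, cmTensorCoord y t ≠ 0 → tensorDegree (cmDeg Φ) y = 0 := by
  constructor
  · intro ht y hy
    have h := tensorSpaceToBaseChange_mem_span_degree_zero (ofCMType Φ) (cmBasis K)
      (ofCMType_F_eq_span Φ) (complexConj_ofCMType_F_eq_span Φ) hab ht
    rw [(hodgeTensorBasis (cmBasis K) a b).mem_span_image] at h
    exact h (by rw [Finset.mem_coe, Finsupp.mem_support_iff]; exact hy)
  · intro h
    refine mem_hodgeClasses_of_mem_span_degree_zero (ofCMType Φ) (cmBasis K) (ofCMType_F_eq_span Φ) ?_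
    rw [(hodgeTensorBasis (cmBasis K) a b).mem_span_image]
    intro y hy
    rw [Finset.mem_coe, Finsupp.mem_support_iff] at hy
    exact h y hy

/-- **The derivation action of `K` in coordinates**: multiplication by `x ∈ K` (an endomorphism of
`V = K`) acts on `T^{a,b}(K)` by the Leibniz rule, and on the `(s,t)`-coordinate by the scalar
`Σᵢ sᵢ(x) − Σⱼ tⱼ(x)` — the differential of the character `Σ e_{sᵢ} − Σ e_{tⱼ}` of `E^*` at `x`
(`(x · –)_ℂ` is diagonal in `e_σ` with eigenvalues `σ(x)`). [cite: Deligne1982HodgeCycles, I §3.1 and Ex. 3.7] -/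
theorem cmTensorCoord_tensorDerivation_lmul (y : (Fin a → (K →+* ℂ)) × (Fin b → (K →+* ℂ))) (x : K)
    (t : hodgeTensorSpace K a b) :
    cmTensorCoord y (tensorDerivation a b (Algebra.lmul ℚ K x : Module.End ℚ K) t) =
      ((∑ i, (y.1 i) x) - ∑ j, (y.2 j) x) * cmTensorCoord y t := by
  rw [cmTensorCoord_apply, cmTensorCoord_apply, ← hodgeTensorSpaceBaseChange_one_tmul,
    ← hodgeTensorSpaceBaseChange_one_tmul, ← LinearMap.baseChange_tmul,
    hodgeTensorSpaceBaseChange_tensorDerivation]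
  have hD := tensorDerivation_hodgeTensorBasis' (a := a) (b := b) (cmBasis K) (lmul_baseChange_cmBasis x)
  have key := basisRepr_apply_of_diag (R := ℂ) (ι := (Fin a → (K →+* ℂ)) × (Fin b → (K →+* ℂ)))
    (M := hodgeTensorSpaceOver ℂ (ℂ ⊗[ℚ] K) a b) (hodgeTensorBasis (cmBasis K) a b)
    (D := tensorDerivation a b ((Algebra.lmul ℚ K x : Module.End ℚ K).baseChange ℂ))
    (d := fun z => (∑ i, (z.1 i) x) - ∑ j, (z.2 j) x) hD
  exact key _ y

omit [NumberField K] in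
/-- The degree of a translated index: `deg_Φ (g • y) = deg_{g⁻¹Φ} (y)`, i.e.
`Σᵢ [g sᵢ ∈ Φ] − Σⱼ [g tⱼ ∈ Φ]` counts membership in the translated type `g⁻¹ • Φ`.
[cite: Dodson1987, §1.1 (p. 50)] -/
theorem tensorDegree_cmDeg_smul (g : ℂ ≃+* ℂ) (Ψ : CMType K)
    (hΨ : Ψ.1 = g⁻¹ • Φ.1) (y : (Fin a → (K →+* ℂ)) × (Fin b → (K →+* ℂ))) :
    tensorDegree (cmDeg Φ) (g • y) = tensorDegree (cmDeg Ψ) y := by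
  have key : ∀ σ : K →+* ℂ, cmDeg Φ (g • σ) = cmDeg Ψ σ := by
    intro σ
    by_cases h : g • σ ∈ Φ.1
    · rw [cmDeg_of_mem Φ h, cmDeg_of_mem Ψ (by rw [hΨ, Set.mem_inv_smul_set_iff]; exact h)]
    · rw [cmDeg_of_notMem Φ h, cmDeg_of_notMem Ψ (by rw [hΨ, Set.mem_inv_smul_set_iff]; exact h)]
  simp only [tensorDegree_apply, Prod.smul_fst, Prod.smul_snd, Pi.smul_apply, key]

/-! ### The parametrisation of `T^{a,b}(K)` by the algebra `K^{⊗(a+b)}` and its characters -/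

variable (K a b) in
/-- **The parametrisation `K^{⊗(a ⊔ b)} → T^{a,b}(K)`**, `⊗ₖ uₖ ↦ (⊗ᵢ u_{inl i}) ⊗ (⊗ⱼ Tr(u_{inr j} · –))`
(a `ℚ`-linear isomorphism, the second factor through the trace form): it lets the commutative
`ℚ`-algebra `K ⊗_ℚ ⋯ ⊗_ℚ K` (Mathlib's algebra structure on `PiTensorProduct`) act as bookkeeping
device for rational tensors — Pohlmann's monomials `∏ x_{iσ}` in the eigen-coordinates of `Aⁿ`.
[cite: Pohlmann1968, §1] -/
def tensorOfCMAlgebra : (⨂[ℚ] _ : Fin a ⊕ Fin b, K) →ₗ[ℚ] hodgeTensorSpace K a b :=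
  TensorProduct.map LinearMap.id
      (PiTensorProduct.map fun _ : Fin b => (traceDualEquiv K : K →ₗ[ℚ] Module.Dual ℚ K)) ∘ₗ
    (PiTensorProduct.tmulEquiv (ι := Fin a) (ι₂ := Fin b) ℚ K).symm.toLinearMap

/-- `tensorOfCMAlgebra` on a pure tensor. [cite: Pohlmann1968, §1] -/
theorem tensorOfCMAlgebra_tprod (u : Fin a ⊕ Fin b → K) :
    tensorOfCMAlgebra K a b (PiTensorProduct.tprod ℚ u) =
      (PiTensorProduct.tprod ℚ fun i => u (Sum.inl i)) ⊗ₜ[ℚ]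
        PiTensorProduct.tprod ℚ fun j => (traceDualEquiv K (u (Sum.inr j)) : Module.Dual ℚ K) := by
  rw [tensorOfCMAlgebra, LinearMap.comp_apply, LinearEquiv.coe_coe, PiTensorProduct.tmulEquiv_symm_apply,
    TensorProduct.map_tmul, LinearMap.id_apply, PiTensorProduct.map_tprod]
  rfl

/-- `tensorOfCMAlgebra` is a linear isomorphism (the trace form is nondegenerate). [cite: Pohlmann1968, §1] -/
theorem tensorOfCMAlgebra_bijective : Function.Bijective (tensorOfCMAlgebra K a b) := by
  rw [tensorOfCMAlgebra, LinearMap.coe_comp]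
  refine Function.Bijective.comp ?_ (PiTensorProduct.tmulEquiv ℚ K).symm.bijective
  exact (TensorProduct.congr (LinearEquiv.refl ℚ _)
    (PiTensorProduct.congr fun _ : Fin b => traceDualEquiv K)).bijective

/-- **The character `χ_y : K^{⊗(a ⊔ b)} → ℂ` of an index** `y = (s, t)`: the `ℚ`-algebra homomorphism
`⊗ₖ uₖ ↦ ∏ᵢ sᵢ(u_{inl i}) · ∏ⱼ tⱼ(u_{inr j})` (a point of `Spec (K ⊗ ⋯ ⊗ K)` over `ℂ`; the character
`Σ e_{sᵢ} + Σ e_{tⱼ}` of `X(E^{* a+b}) = ℤ^{S^{a+b}}`). [cite: Deligne1982HodgeCycles, I Ex. 3.7] -/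
def embProdHom (y : (Fin a → (K →+* ℂ)) × (Fin b → (K →+* ℂ))) : (⨂[ℚ] _ : Fin a ⊕ Fin b, K) →ₐ[ℚ] ℂ :=
  PiTensorProduct.liftAlgHom
    ((MultilinearMap.mkPiAlgebra ℚ (Fin a ⊕ Fin b) ℂ).compLinearMap fun k =>
      ((Sum.elim y.1 y.2 k : K →+* ℂ).toRatAlgHom).toLinearMap)
    (by simp [MultilinearMap.mkPiAlgebra_apply])
    (fun u u' => by simp [MultilinearMap.mkPiAlgebra_apply, Finset.prod_mul_distrib])

/-- The character on a pure tensor: `χ_{(s,t)}(⊗ₖ uₖ) = ∏ᵢ sᵢ(u_{inl i}) ∏ⱼ tⱼ(u_{inr j})`.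
[cite: Deligne1982HodgeCycles, I Ex. 3.7] -/
theorem embProdHom_tprod (y : (Fin a → (K →+* ℂ)) × (Fin b → (K →+* ℂ))) (u : Fin a ⊕ Fin b → K) :
    embProdHom y (PiTensorProduct.tprod ℚ u) =
      (∏ i, y.1 i (u (Sum.inl i))) * ∏ j, y.2 j (u (Sum.inr j)) := by
  rw [embProdHom, PiTensorProduct.liftAlgHom_apply, PiTensorProduct.lift.tprod,
    MultilinearMap.compLinearMap_apply, MultilinearMap.mkPiAlgebra_apply, Fintype.prod_sum_type]
  rfl

/-- The character on a generator `1 ⊗ ⋯ ⊗ z ⊗ ⋯ ⊗ 1` (slot `k`): `χ_y = y_k(z)`.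
[cite: Deligne1982HodgeCycles, I Ex. 3.7] -/
theorem embProdHom_singleAlgHom (y : (Fin a → (K →+* ℂ)) × (Fin b → (K →+* ℂ)))
    (k : Fin a ⊕ Fin b) (z : K) :
    embProdHom y (PiTensorProduct.singleAlgHom k z) = (Sum.elim y.1 y.2 k : K →+* ℂ) z := by
  rw [PiTensorProduct.singleAlgHom_apply, embProdHom, PiTensorProduct.liftAlgHom_apply,
    PiTensorProduct.lift.tprod, MultilinearMap.compLinearMap_apply, MultilinearMap.mkPiAlgebra_apply,
    Finset.prod_eq_single k]
  · simp
  · intro k' _ hk'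
    simp [hk']
  · intro h
    exact absurd (Finset.mem_univ k) h

/-- **The coordinate IS the character**: `coord_y (tensorOfCMAlgebra u) = χ_y(u)` for all
`u ∈ K^{⊗(a ⊔ b)}`. [cite: Deligne1982HodgeCycles, I Ex. 3.7] [cite: Pohlmann1968, §1] -/
theorem cmTensorCoord_tensorOfCMAlgebra (y : (Fin a → (K →+* ℂ)) × (Fin b → (K →+* ℂ)))
    (u : ⨂[ℚ] _ : Fin a ⊕ Fin b, K) :
    cmTensorCoord y (tensorOfCMAlgebra K a b u) = embProdHom y u := by
  suffices h : cmTensorCoord y ∘ₗ tensorOfCMAlgebra K a b = (embProdHom y).toLinearMap from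
    LinearMap.congr_fun h u
  ext u
  rw [LinearMap.compMultilinearMap_apply, LinearMap.compMultilinearMap_apply, LinearMap.comp_apply,
    tensorOfCMAlgebra_tprod, cmTensorCoord_tprod_tmul_tprod, AlgHom.toLinearMap_apply, embProdHom_tprod]
  congr 1
  exact Finset.prod_congr rfl fun j _ => by rw [LinearEquiv.symm_apply_apply]

/-- **`Aut(ℂ)` permutes the characters**: `χ_{g • y} = g ∘ χ_y`. [cite: Deligne1982HodgeCycles, I Ex. 3.7] -/
theorem embProdHom_smul (g : ℂ ≃+* ℂ) (y : (Fin a → (K →+* ℂ)) × (Fin b → (K →+* ℂ)))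
    (u : ⨂[ℚ] _ : Fin a ⊕ Fin b, K) : embProdHom (g • y) u = g (embProdHom y u) := by
  rw [← cmTensorCoord_tensorOfCMAlgebra, ← cmTensorCoord_tensorOfCMAlgebra, cmTensorCoord_smul]

/-- **The characters separate the indices**: `χ_y = χ_{y'}` forces `y = y'` (evaluate on the
generators `1 ⊗ ⋯ ⊗ z ⊗ ⋯ ⊗ 1`). [cite: Deligne1982HodgeCycles, I Ex. 3.7] -/
theorem embProdHom_injective :
    Function.Injective (embProdHom (K := K) (a := a) (b := b)) := by
  intro y y' h
  have key : ∀ k, (Sum.elim y.1 y.2 k : K →+* ℂ) = Sum.elim y'.1 y'.2 k := fun k =>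
    RingHom.ext fun z => by rw [← embProdHom_singleAlgHom, ← embProdHom_singleAlgHom, h]
  obtain ⟨s, t⟩ := y
  obtain ⟨s', t'⟩ := y'
  simp only [Prod.mk.injEq]
  exact ⟨funext fun i => key (Sum.inl i), funext fun j => key (Sum.inr j)⟩

end HodgeStructure

end Literature.AlgebraicGeometry.Motives

end
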